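import Summits.BirchSwinnertonDyer.BirchSwinnertonDyer.Theorems.ClassRecordThreeCornerAtThreeShimuraFamilyLevelData
import Summits.BirchSwinnertonDyer.BirchSwinnertonDyer.Theorems.ClassRecordThreeCornerAtThreeShimuraCarrierOfNoTorsion
import HarnessLib

/-!
# The KEY RELATION (McCallum 1991 Prop. 4.4 ∕ Gross Prop. 3.7 + 4.x at `λ ∣ ℓ ∣ m`) for the classes of a COHERENT family of generalised
# Kolyvagin data, from the labels (B4) (trace) and (B5) (congruence) — shim-p1's `h37_of_labels` + `h44_of_prop37_on_of_conductorNorm` RUN on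
# the family level-data package (cell `bsd-stepL`, seat `bsd-stepL-corner3-p2` g8 = WIDTH-LEVER lane B; `--supports stmt-BirchSwinnertonDyer-21420 --as helper`)

WHY (PORT MAP (P2) §2 (ii) «`h47` ∕ Prop. 4.4: X₀(N) = `JET.prop44_of_frobeniusCongruence h372`; twin input = label (B5) (+ (B4))»; RULING 47 (4)).
The walk's `h47` (order of `loc_λ κ(sℓ)` = order of `loc_λ κ(s)`) and the swap's `h44c` rest on the key relation at a Kolyvagin prime `ℓ ∣ m` and
the place `λ ∣ ℓ`: «`p^a · c_M(m)` is Selmer at `λ` iff `p^a · c_M(m∕ℓ)` is locally trivial at `λ`». g5's image-keyed carrier proved it for the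
labelled CM family INTERNALLY (clause «key relation») and hid the data; THIS FILE proves it for the classes `(d m hm).kolyvaginClass hp M` of a
COHERENT family `d : (m ∣ n) → JET.KolyvaginFamilyData W K ι m` (coherence = `ShimuraWalk.exists_coherent_familyData_y_eq`'s last conjunct,
`…ShimuraFamilyCoherentData`), from (B4) and (B5) in datum form, admissibility, `p` odd, on the level-data package
(`exists_levelData_familyData`, p599103): Gross 3.7 in Kolyvagin–Euler currency by shim-p1's `h37_of_labels` (K3), then McCallum 4.4 by shim-p1's
`h44_of_prop37_on_of_conductorNorm` (K2: ring-class decomposition at `λ`, total ramification, Weil pairing — all tree theorems), the invariance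
`hPt` from (B4) (`map_kolyvaginPoint_mem_invPoints`), inertia `hI` from `KolyvaginH44.smul_kolyvaginPoint_eq_of_mem_localInertia`; junk levels
(`m ∤ n`, `j_m = 0`) carry the trivial module. HONEST FRAMING: one theorem (no definition, no named fact, no `sorry`); CONDITIONAL on the displayed
labels and admissibility; nothing about any Heegner ∕ CM point is constructed; no stub closes; BSD is not proved by any of this; T7.
Credit: shim-p1 g8 (K2∕K3), x11b3 (h44 END, H37 bridge), this seat g5 (carrier pattern), tam3-p1 g12 (datum).
References: [cite: GrossLMS1991, §3 Prop. 3.7 (1)(2), (3.3), §4 (4.1), Prop. 4.x] [cite: McCallumLMS1991, §4 Prop. 4.4, Lemma 4.3]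
[cite: BertoliniDarmon1996, §2.4–2.5] [cite: Nekovar2007, (4.8), (4.9)].
presearch: not applicable (re-keying ∕ instantiation of tree theorems on labels); `lean search 'keyRelation_familyData'` → none.
-/

set_option autoImplicit false
set_option linter.dupNamespace false

noncomputable section

open scoped Classical

namespace Summit.BirchSwinnertonDyer.BirchSwinnertonDyer.Theorems.ShimuraWalk

open WeierstrassCurve Field NumberField IsDedekindDomain Finset
  Literature.NumberTheory.EllipticCurves Literature.NumberTheory.GaloisRepresentations
  Literature.NumberTheory.EllipticCurves.KolyvaginCocycle
  Literature.NumberTheory.EllipticCurves.KolyvaginEuler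
  Literature.NumberTheory.EllipticCurves.RingClassField
  Literature.NumberTheory.EllipticCurves.ModularForms
  Summit.BirchSwinnertonDyer.Rank1Residual.X11b
  Summit.BirchSwinnertonDyer.Rank1Residual.JET
  Summit.BirchSwinnertonDyer.BirchSwinnertonDyer.Theorems

variable {K : Type} [Field K] [NumberField K] {W : WeierstrassCurve ℚ}

set_option maxHeartbeats 1600000 in
/-- **The key relation for the classes of a coherent family of generalised Kolyvagin data, from (B4) + (B5)**; see the module docstring.
[cite: McCallumLMS1991, §4 Prop. 4.4] [cite: GrossLMS1991, §3 Prop. 3.7, §4 (4.1)] -/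
theorem keyRelation_familyData_of_labels {N : ℕ} [NeZero N] [W.IsElliptic] [W.IsGloballyMinimal]
    (hK : IsImaginaryQuadratic K) (ι : K →+* ℂ) (hN : W.conductorNorm ℤ = N)
    {p M : ℕ} (hp : p.Prime) (hp2 : p ≠ 2) (hM : 1 ≤ M) (Dt : ModularParametrizationData W N)
    {n : ℕ} (hn : Squarefree n)
    (hKol : ∀ q ∈ n.primeFactors, IsKolyvaginPrime N W K p q ∧ FrobEqFrobInfty W K (p ^ M) q)
    (d : (m : ℕ) → m ∣ n → KolyvaginFamilyData W K ι m)
    (hcoh : ∀ (m : ℕ) (hm : m ∣ n) (ℓ : ℕ) (hℓ : ℓ ∈ m.primeFactors)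
      (hle : ringClassField K ι (m / ℓ) ≤ ringClassField K ι m),
      letI : Algebra K ℂ := ι.toAlgebra
      (d m hm).toGeomPoints
          (KolyvaginOperator.derivedPoint (pointGalHom W (ringClassField K ι m)) (d m hm).σ (m / ℓ) (d m hm).S
            (WeierstrassCurve.Affine.Point.map (W' := W)
              ((RingClassField.inclusion ι hle).restrictScalars ℚ)
              ((d (m / ℓ) ((Nat.div_dvd_of_dvd (Nat.dvd_of_mem_primeFactors hℓ)).trans hm)).y))) =
        (d (m / ℓ) ((Nat.div_dvd_of_dvd (Nat.dvd_of_mem_primeFactors hℓ)).trans hm)).toGeomPoints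
          (d (m / ℓ) ((Nat.div_dvd_of_dvd (Nat.dvd_of_mem_primeFactors hℓ)).trans hm)).derivedPoint)
    (hB4d : ∀ (m : ℕ) (hm : m ∣ n), ∀ (ℓ : ℕ) (hℓ : ℓ ∈ m.primeFactors)
      (hle : ringClassField K ι (m / ℓ) ≤ ringClassField K ι m),
      letI : Algebra K ℂ := ι.toAlgebra
      ∑ i ∈ Finset.range (ℓ + 1), pointGalHom W (ringClassField K ι m) ((d m hm).σ ℓ ^ i) (d m hm).y =
        W.frobeniusTrace ℓ • WeierstrassCurve.Affine.Point.map (W' := W)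
          ((RingClassField.inclusion ι hle).restrictScalars ℚ)
          (d (m / ℓ) ((Nat.div_dvd_of_dvd (Nat.dvd_of_mem_primeFactors hℓ)).trans hm)).y)
    (hB5d : ∀ (m : ℕ) (hm : m ∣ n) (ℓ : ℕ) (hℓ : ℓ ∈ m.primeFactors) [Fact ℓ.Prime]
      (hΔ : ¬ (ℓ : ℤ) ∣ minimalDiscriminantInt W) (φ₀ : absoluteGaloisGroup (ZMod ℓ)),
      (∀ x : AlgebraicClosure (ZMod ℓ), φ₀ • x = x ^ ℓ) →
      ∀ (hle : ringClassField K ι (m / ℓ) ≤ ringClassField K ι m)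
        (γ : ringClassField K ι m ≃ₐ[ℚ] ringClassField K ι m), γ ∈ ringClassGal ι m →
        letI : Algebra K ℂ := ι.toAlgebra
        geomReduction hΔ ((RatClosure.pointsEquiv (K := K) W).symm
            ((d m hm).toGeomPoints (pointGalHom W (ringClassField K ι m) γ (d m hm).y))) =
          φ₀ • geomReduction hΔ ((RatClosure.pointsEquiv (K := K) W).symm
            ((d m hm).toGeomPoints (pointGalHom W (ringClassField K ι m) γ
              (WeierstrassCurve.Affine.Point.map (W' := W)
                ((RingClassField.inclusion ι hle).restrictScalars ℚ)
                (d (m / ℓ) ((Nat.div_dvd_of_dvd (Nat.dvd_of_mem_primeFactors hℓ)).trans hm)).y)))))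
    (hA : ∀ (m : ℕ) (hm : m ∣ n),
      IsAdmissible (absoluteGaloisGroup K) (d m hm).pointsSubgroup ((p ^ M : ℕ) : ℤ)) :
    ∀ (m : ℕ) (hm : m ∣ n) (ℓ : ℕ) (hℓ : ℓ ∈ m.primeFactors) (v : HeightOneSpectrum (𝓞 K)),
      (ℓ : 𝓞 K) ∈ v.asIdeal → ∀ a : ℕ,
        (((p : ℤ) ^ a) • (d m hm).kolyvaginClass hp M ∈
            selmerLocalKer (W.baseChange K) (v.adicCompletion K) ((p ^ M : ℕ) : ℤ) ↔
          ((p : ℤ) ^ a) • (d (m / ℓ) ((Nat.div_dvd_of_dvd (Nat.dvd_of_mem_primeFactors hℓ)).trans hm)).kolyvaginClass hp M ∈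
            (W.baseChange K).torsionLocalKer (v.adicCompletion K) ((p ^ M : ℕ) : ℤ)) := by
  intro m hm ℓ hℓ v hv a
  haveI : Fact p.Prime := ⟨hp⟩
  letI : Algebra K ℂ := ι.toAlgebra
  have hn0 : n ≠ 0 := Squarefree.ne_zero hn
  have hm0 : m ≠ 0 := ne_zero_of_dvd_ne_zero hn0 hm
  have hℓp : ℓ.Prime := Nat.prime_of_mem_primeFactors hℓ
  have hℓm : ℓ ∣ m := Nat.dvd_of_mem_primeFactors hℓ
  have hm' : m / ℓ ∣ n := (Nat.div_dvd_of_dvd hℓm).trans hm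
  have hinert : ∀ q ∈ n.primeFactors, (Ideal.span {(q : 𝓞 K)}).IsPrime :=
    fun q hq ↦ (hKol q hq).1.2.2.2.2.1
  have hdiv : ∀ Q : geomPoints (W.baseChange K), ∃ R, ((p ^ M : ℕ) : ℤ) • R = Q :=
    (W.baseChange K).zsmul_geomPoints_surjective_of_charZero
      (by exact_mod_cast pow_ne_zero M hp.ne_zero)
  -- the structures and THE SEAM
  letI hcg : ∀ k, CommGroup (ringClassGal ι k) := fun k ↦
    { (inferInstance : Group (ringClassGal ι k)) with
      mul_comm := fun a b ↦ (KolyvaginH44.isMulCommutative_ringClassGal' hK ι k).is_comm.comm a b }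
  letI act : ∀ k, DistribMulAction (ringClassGal ι k)
      ((W.baseChange (ringClassField K ι k)).toAffine.Point) := fun k ↦
    DistribMulAction.compHom _ ((pointGalHom W (ringClassField K ι k)).comp (ringClassGal ι k).subtype)
  choose σ H hF f y π j e hord hj hπρ hfsec hHρ hdict hjunk using
    fun k ↦ exists_levelData_familyData (W := W) hK ι hn hinert d k
  letI hft : ∀ k, Fintype (ringClassGal ι k ⧸ H k) := hF
  have hsmul : ∀ (k) (g : ringClassGal ι k) (Q : (W.baseChange (ringClassField K ι k)).toAffine.Point),
      g • Q = pointGalHom W (ringClassField K ι k)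
        (g : ringClassField K ι k ≃ₐ[ℚ] ringClassField K ι k) Q := fun _ _ _ ↦ rfl
  set ρ : ∀ k, ringClassGal ι k →* (ringClassField K ι k ≃ₐ[ℚ] ringClassField K ι k) :=
    fun k ↦ (ringClassGal ι k).subtype with hρdef
  have hρ : ∀ k, Function.Injective (ρ k) := fun k ↦ (ringClassGal ι k).subtype_injective
  have hj' : ∀ (k) (g : absoluteGaloisGroup K)
      (a : (W.baseChange (ringClassField K ι k)).toAffine.Point),
      j k (π k g • a) = g • j k a := fun k g a ↦ by rw [hsmul]; exact hj k g a
  have hπρ' : ∀ (k) (τ : absoluteGaloisGroup K) (x : ringClassField K ι k),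
      τ • e k x = e k (ρ k (π k τ) x) := fun k τ x ↦ hπρ k τ x
  -- dictionary clauses at the divisors
  have hjm : ∀ (k) (hk : k ∣ n), j k = (d k hk).toGeomPoints := fun k hk ↦ (hdict k hk).1
  have hym : ∀ (k) (hk : k ∣ n), y k = (d k hk).y := fun k hk ↦ (hdict k hk).2.1
  have hσA : ∀ (k) (hk : k ∣ n), ∀ q ∈ k.primeFactors, ρ k (σ k q) = (d k hk).σ q :=
    fun k hk ↦ (hdict k hk).2.2.1
  have hfS : ∀ (k) (hk : k ∣ n) (c : ringClassGal ι k ⧸ H k), ρ k (f k c) ∈ (d k hk).S :=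
    fun k hk ↦ (hdict k hk).2.2.2.1
  have hPm : ∀ (k) (hk : k ∣ n), kolyvaginPoint (σ k) k.primeFactors (f k) (y k) = (d k hk).derivedPoint :=
    fun k hk ↦ (hdict k hk).2.2.2.2.2
  have hz : ∀ k : ℕ, k ∣ n → ∀ q ∈ k.primeFactors,
      (Subgroup.zpowers (σ k q)).map (ρ k) = ringClassGalOver ι k (k / q) := fun k hk q hq ↦ by
    rw [MonoidHom.map_zpowers, hσA k hk q hq]; exact (d k hk).zpowers_σ q hq
  -- Euler hypotheses at every divisor (from (B4) + (3.3))
  have hgen : ∀ (k) (hk : k ∣ n), H k ≤ Subgroup.closure (σ k '' (k.primeFactors : Set ℕ)) := fun k hk ↦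
    le_closure_of_map_zpowers hK ι (hn.squarefree_of_dvd hk) (σ k) (H k) (ρ k) (hρ k) (hz k hk) (hHρ k)
  have hdvd : ∀ (k) (_ : k ∣ n), ∀ q ∈ k.primeFactors, ((p ^ M : ℕ) : ℤ) ∣ ((q + 1 : ℕ) : ℤ) := by
    intro k hk q hq
    obtain ⟨hqK, hqM⟩ := hKol q (Nat.primeFactors_mono hk hn0 hq)
    exact (IsKolyvaginPrime.pow_dvd_add_one W hp hqK hM hqM).1
  have htrA : ∀ (k) (hk : k ∣ n), ∀ q ∈ k.primeFactors,
      grAct ((W.baseChange (ringClassField K ι k)).toAffine.Point) (traceElt (σ k q) q) (y k) ∈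
        zsmulRange ((W.baseChange (ringClassField K ι k)).toAffine.Point) ((p ^ M : ℕ) : ℤ) := by
    intro k hk q hq
    have hk0 : k ≠ 0 := ne_zero_of_dvd_ne_zero hn0 hk
    have hle : ringClassField K ι (k / q) ≤ ringClassField K ι k :=
      ringClassField_mono hK ι (Nat.div_dvd_of_dvd (Nat.dvd_of_mem_primeFactors hq)) hk0
    have hrel : grAct ((W.baseChange (ringClassField K ι k)).toAffine.Point) (traceElt (σ k q) q) (y k) =
        W.frobeniusTrace q • WeierstrassCurve.Affine.Point.map (W' := W)
          ((RingClassField.inclusion ι hle).restrictScalars ℚ)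
          (d (k / q) ((Nat.div_dvd_of_dvd (Nat.dvd_of_mem_primeFactors hq)).trans hk)).y := by
      rw [grAct_traceElt, hym k hk, ← hB4d k hk q hq hle]
      refine Finset.sum_congr rfl fun i _ ↦ ?_
      rw [hsmul, Subgroup.coe_pow,
        show (σ k q : ringClassField K ι k ≃ₐ[ℚ] ringClassField K ι k) = (d k hk).σ q from hσA k hk q hq]
    exact grAct_traceElt_mem_of_eq_smul hrel
      (pow_dvd_frobeniusTrace_of_kolyvaginPrime (K := K) Dt hp hM (hKol q (Nat.primeFactors_mono hk hn0 hq)).1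
        (hKol q (Nat.primeFactors_mono hk hn0 hq)).2)
  -- admissibility and invariance at EVERY level (junk levels carry the trivial module)
  have hAt : ∀ k, IsAdmissible (absoluteGaloisGroup K) (j k).range ((p ^ M : ℕ) : ℤ) := by
    intro k
    by_cases hk : k ∣ n
    · rw [hjm k hk]; exact hA k hk
    · rw [hjunk k hk]
      exact ⟨fun g x hx ↦ by
          obtain ⟨a', rfl⟩ := hx
          exact ⟨a', by rw [AddMonoidHom.zero_apply, smul_zero]⟩,
        fun x hx _ ↦ by
          obtain ⟨a', rfl⟩ := hx
          rw [AddMonoidHom.zero_apply]⟩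
  have hPtt : ∀ k, j k (kolyvaginPoint (σ k) k.primeFactors (f k) (y k)) ∈
      invPoints (absoluteGaloisGroup K) (j k).range ((p ^ M : ℕ) : ℤ) := by
    intro k
    by_cases hk : k ∣ n
    · exact map_kolyvaginPoint_mem_invPoints (hfsec k) (hgen k hk) (hord k) (hdvd k hk) (htrA k hk) (π k) (j k) (hj' k)
    · rw [hjunk k hk, AddMonoidHom.zero_apply]; exact AddSubgroup.zero_mem _
  have hIt : ∀ k : ℕ, ∀ v : HeightOneSpectrum (𝓞 K), (k : 𝓞 K) ∉ v.asIdeal →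
      ∀ 𝔐 ∈ v.localPrimesAbove, ∀ t ∈ 𝔐.inertia (absoluteGaloisGroup (v.adicCompletion K)),
        resGal (K := K) (v.adicCompletion K) t • j k (kolyvaginPoint (σ k) k.primeFactors (f k) (y k)) =
          j k (kolyvaginPoint (σ k) k.primeFactors (f k) (y k)) :=
    KolyvaginH44.smul_kolyvaginPoint_eq_of_mem_localInertia (W := W) hK ι σ
      (fun k ↦ k.primeFactors) H f y π j hj' e ρ hρ hπρ'
  -- Gross 3.7 in Kolyvagin–Euler currency from (B4) + (B5) + coherence (shim-p1's K3)
  have h37t := h37_of_labels (W := W) (N := N) hK ι p M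
    (fun k hk ↦ (d k hk).y) (fun k hk ↦ (d k hk).σ) (fun k hk ↦ (d k hk).S)
    (fun k hk ↦ (d k hk).S_subset) (fun k hk ↦ (d k hk).S_transversal) (fun k hk ↦ (d k hk).toGeomPoints)
    hcoh hB4d (fun k hk q hq _ hΔ φ₀ hφ₀ hle γ hγ ↦ hB5d k hk q hq hΔ φ₀ hφ₀ hle γ hγ)
    σ (fun k ↦ k.primeFactors) H f y j ρ hρ (fun _ ↦ AddEquiv.refl _)
    (fun k _ g a ↦ hsmul k g a) (fun k hk a ↦ by rw [hjm k hk]; rfl) (fun k hk ↦ hym k hk) hσA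
    (fun _ _ ↦ rfl) (fun k _ ↦ hfsec k) hfS (fun k _ ↦ hHρ k) (fun _ _ g ↦ g.2)
    (fun k hk s hs ↦ ⟨⟨s, (d k hk).S_subset s hs⟩, rfl⟩)
  -- McCallum Prop. 4.4 (shim-p1's K2)
  have h44 := h44_of_prop37_on_of_conductorNorm hK ι hN hp hp2 hM (W.exists_weilPairing_holds p) hdiv σ
    (fun k ↦ k.primeFactors) H f hord y π j hj' hAt hPtt hIt (fun k ↦ k ∣ n) h37t e ρ hρ hπρ' hz
    m hm (hn.squarefree_of_dvd hm) (fun q hq ↦ hKol q (Nat.primeFactors_mono hm hn0 hq)) ℓ hℓp hℓm v hv a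
  -- the abstract classes ARE the datum classes
  have hcls : ∀ (k) (hk : k ∣ n), (d k hk).kolyvaginClass hp M =
      kolyvaginClass (W.baseChange K) ((p ^ M : ℕ) : ℤ) hdiv (hAt k)
        (j k (kolyvaginPoint (σ k) k.primeFactors (f k) (y k))) (hPtt k) := by
    intro k hk
    have hP : j k (kolyvaginPoint (σ k) k.primeFactors (f k) (y k)) =
        (d k hk).toGeomPoints (d k hk).derivedPoint := by rw [hjm k hk, hPm k hk]
    have hPt : (d k hk).toGeomPoints (d k hk).derivedPoint ∈
        invPoints (absoluteGaloisGroup K) (d k hk).pointsSubgroup ((p ^ M : ℕ) : ℤ) := by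
      have h := hPtt k
      rw [hP, hjm k hk] at h
      exact h
    rw [KolyvaginFamilyData.kolyvaginClass_def, dif_pos ⟨hA k hk, hPt⟩]
    exact KolyvaginH44.kolyvaginClass_congr (by rw [hjm k hk]; rfl) hP.symm
  rw [hcls m hm, hcls (m / ℓ) hm']
  exact h44

end Summit.BirchSwinnertonDyer.BirchSwinnertonDyer.Theorems.ShimuraWalk

end
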